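/-
Copyright (c) 2026 the pub-hodgecm-mathlib formalisation cell (harness21).  Typist seat hodgecm-mathlib-R90-C10-typ1 (g4), R90-TF section S1 «Ch10-local» (A-file pen by lineage);
authored 2026-09-05 (offer (o1a) to the S1 dealer R90-C10-plan (g2)); filer = the prover hand the dealer names (this seat proposes no theorems).
KERNEL module: THEOREMS ONLY (no definition, no named fact, no `sorry`, no instance, no notation).  ONE theorem.
-/
import Summits.HodgeConjecture.HodgeConjecture.Theorems.K2E3KeysThmTwoContractingRamifiedCharOneDepthZero  -- ★ p862943 (K2E3-p32 (g2)): `keysThmTwo_ramifiedCharOne_depthZero_normTrivial` = U4Keys :155 (U4f-χ₁-ram-one-d0B) AS A THEOREM (depth zero, Branch B, every non-split place)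
import Summits.HodgeConjecture.HodgeConjecture.Theorems.K2E3BranchAIrreducibleDepthZeroLeaf                  -- ★ p859317 (K2E3-p06 (g4)): `not_reducible_of_depthZero_of_normChar_ne_one` — Branch A at depth zero is IRREDUCIBLE (design D-I «vanishing functional»)
import HarnessLib

/-!
# R90-TF · S1 «Ch10-local» — THE JUNCTION SOCKET A2′ AS A FUNCTION OF ONE NAMED LETTER (law L9 THEOREMS TWIN of the U4Keys ED. 8 tie):
# Keys' Theorem §7 (2) («`Re s > 0`» form) for a RAMIFIED `χ₁` at `χ₂ = 1`, every non-split place ⟸ its POSITIVE-DEPTH case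
# [Keys1984 §7 Thm (2) p. 126; Rogawski1990 §12.2 (1)–(2) p. 173; Casselman1995 §6.4; MoyPrasad1996 §3]

Cell `pub/hodgecm-mathlib`, crux H413 = `stmt-HodgeConjecture-24833`, route of record `HCCMUnconditional` (no route verbs); R90-TF section S1, file A
`Cruxes/H413/Lines/R90_S1_NonsplitLocalPacketsA.lean` ED. 2 (0f3e1ea9c10b8017, BUILT), whose ONE remaining socket is the junction socket A2′ :154
`stub_R90_122_keysThmTwo_ramifiedCharOne (v) (hns)` (RULING R-S1-4: one statement, two sections — its ∀-closure over `(L, v, hns)` IS the ∀-text of the K2 E3 organ's Lines socket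
`…Cruxes.H413.K2E3EllipticInputs.U4Keys.sig_K2E3KeysThmTwoContractingRamifiedCharOne` (U4f-χ₁-ram-one) TOKEN FOR TOKEN).  THEOREMS ONLY; lane `--supports stmt-HodgeConjecture-24833
--as helper`, count-neutral.

WHAT THIS FILE IS.  S1 pays its sockets LINES-FREE (law L9 «definitions down»: every payment of file A is a ★ `Theorems` declaration imported by the next edition), so A2′ needs a
★ THEOREMS declaration of its closed type.  The K2 E3 organ tied (U4f-χ₁-ram-one) INSIDE its Lines file (U4Keys ED. 8, K2E3-p06 (g4) cand v5 f5d0572a22ad1583: `by_cases` depth zero →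
`by_cases` Branch B → (d0B) ∣ Branch A ABSURD; positive depth → the socket :182 (U4f-χ₁-ram-one-pos) `sig_K2E3KeysThmTwoContractingRamifiedCharOnePosDepth`); this module is the
THEOREMS TWIN of that tie, HYPOTHESIS-FIRST: the ONE open input — the positive-depth case, i.e. the ∀-text of :182 VERBATIM — is the hypothesis `hPos`, and the two depth-zero inputs are
consumed BY NAME from ★ `Theorems`:
* depth zero, Branch B (`χ₁(u·σu) = 1` on units): ★ p862943 `K2E3KeysThmTwoContractingRamifiedCharOneDepthZero.keysThmTwo_ramifiedCharOne_depthZero_normTrivial` (K2E3-p32 (g2); inert: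
  the «U4-RAM» d0B chain; ramified: ★ p862851 `R90.S1.exists_eta_of_reducible_ramified`, R90-C10-p08 (g2));
* depth zero, Branch A (`χ₁(u·σu) ≠ 1` for some unit `u`): reducibility is ABSURD by ★ p859317 `K2E3BranchAIrreducibleDepthZeroLeaf.not_reducible_of_depthZero_of_normChar_ne_one`.
So the conclusion — the ∀-text of (U4f-χ₁-ram-one) = A2′ ∀-closed — is ONE TERM over ONE named letter.  The letter :182 is itself tied place-first in U4Keys ED. 10 (K2E3-plan (g6)) over
the three sockets (S-I) inert Branch B [payer: S1 (B-7⁺) `R90S1KeysThmTwoPosDepthBranchBInertAllLeaf`, ★ p863671 body] ∕ (S-RT) tame-ramified Branch B [payer: S1 (B-10) leaf (8)] ∕ (S-W)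
wild dyadic (XL residual, no hand); its Theorems twin `R90.S1.keysThmTwo_posDepth_of_letters` is the companion file (o1b).  AFTER BOTH: A ED. 3's A2′ line is
`stub_R90_122_keysThmTwo_ramifiedCharOne v hns := R90.S1.keysThmTwo_ramifiedCharOne_of_posDepth (R90.S1.keysThmTwo_posDepth_of_letters sI sRT sW) L v hns` the day `sI sRT sW` are ★.
BYTES.  `hPos` = the statement of `…U4Keys.sig_K2E3KeysThmTwoContractingRamifiedCharOnePosDepth` (tree ED. 9′ :185–:196) VERBATIM; conclusion = the statement of
`…U4Keys.sig_K2E3KeysThmTwoContractingRamifiedCharOne` (tree ED. 9′ :220–:230) VERBATIM; body = the ED. 8 tactic block with `sig_…DepthZeroNormTrivial` ↦ ★ p862943, `sig_…PosDepth` ↦ `hPos`.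
HONEST LABEL.  HC_CM is proved only modulo the 7 printed citations (2 remaining named inputs: hLiu418 = `stmt-HodgeConjecture-24832`, h413 = `stmt-HodgeConjecture-24833`) until rung 0
closes; count-neutral — a hypothesis-first twin RE-EXPRESSES the open socket A2′ as ONE named open letter (:182) and closes NOTHING: :182 ∕ A2′ stay OPEN ((S-W) unstaffed); no printed
citation is discharged; REL ≠ ★ ≠ BUILT.

## References
* [Keys1984] D. Keys, *Principal series representations of special unitary groups over local fields*, Compositio Math. 51 (1984), §3, §7 Theorem (2) p. 126.
* [Rogawski1990] J. D. Rogawski, *Automorphic Representations of Unitary Groups in Three Variables*, Ann. of Math. Stud. 123 (1990), §12.1 p. 171, §12.2 (1)–(2) p. 173.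
* [Casselman1995] W. Casselman, *Introduction to the theory of admissible representations of `p`-adic reductive groups* (1995), §6.4, Thm. 6.6.2.
* [MoyPrasad1996] A. Moy, G. Prasad, *Jacquet functors and unrefined minimal K-types*, Comment. Math. Helv. 71 (1996), §3.
* [Roche1998] A. Roche, *Types and Hecke algebras for principal series representations of split reductive p-adic groups*, Ann. Sci. ÉNS (4) 31 (1998), §3–§4.
-/

set_option autoImplicit false
-- the mandated namespace has the single-problem summit's repeated segment (`HodgeConjecture.HodgeConjecture`)
set_option linter.dupNamespace false

noncomputable section

open NumberField IsDedekindDomain MeasureTheory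
open scoped Matrix MatrixGroups WithZero Valued NNReal
open Literature.NumberTheory Literature.NumberTheory.Automorphic Literature.NumberTheory.Automorphic.UnitaryGroup

namespace Summit.HodgeConjecture.HodgeConjecture.R90.S1

open Summit.HodgeConjecture.HodgeConjecture.Cruxes.H413

/-- **KEYS' THEOREM §7 (2) («`Re s > 0`» form), RAMIFIED `χ₁`, `χ₂ = 1`, EVERY NON-SPLIT PLACE ⟸ ITS POSITIVE-DEPTH CASE** — the junction socket A2′ of S1 file A (= the ∀-text of
`…U4Keys.sig_K2E3KeysThmTwoContractingRamifiedCharOne` TOKEN FOR TOKEN) from ONE letter `hPos` (= the ∀-text of `…U4Keys.sig_K2E3KeysThmTwoContractingRamifiedCharOnePosDepth` TOKEN FOR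
TOKEN): `v` a finite place of `L⁺` non-split in the CM field `L`; `χ₁ : (L ⊗ L⁺_v)ˣ → ℂˣ` continuous, non-unitary, contracting, NOT trivial on the integral units (`hram`); if `i(χ₁, 1)` is
reducible then `χ₁ = ‖·‖` or `χ₁ = η · ‖·‖^{1∕2}` with `η` a continuous quadratic character extension.  PROOF (= U4Keys ED. 8's tie, Theorems-side): `by_cases` `χ₁` trivial on the principal
units (depth zero) — then `by_cases` Branch B: ★ p862943 `keysThmTwo_ramifiedCharOne_depthZero_normTrivial` ∣ Branch A: reducibility ABSURD by ★ p859317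
`not_reducible_of_depthZero_of_normChar_ne_one`; else (positive depth) the letter `hPos`.
[cite: Keys1984, §7 Theorem (2) p. 126] [cite: Rogawski1990, §12.2 (1)–(2) p. 173] [cite: Casselman1995, §6.4, Thm. 6.6.2] [cite: MoyPrasad1996, §3] -/
theorem keysThmTwo_ramifiedCharOne_of_posDepth
    (hPos :
      ∀ (L : Type) [Field L] [NumberField L] [IsCMField L] (v : HeightOneSpectrum (𝓞 ↥(maximalRealSubfield L))),
          (∀ w : PlacesOver L v, IsCMField.complexConj L • w.1 = w.1) →
          ∀ (χ₁ : (UnitaryGroup.LocalRing L v)ˣ →* ℂˣ),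
            Continuous (fun x => ((χ₁ x : ℂˣ) : ℂ)) → (∃ x, ‖((χ₁ x : ℂˣ) : ℂ)‖ ≠ 1) →
            (∀ x : (UnitaryGroup.LocalRing L v)ˣ, unitModulusChar (UnitaryGroup.LocalRing L v) x < 1 → ‖((χ₁ x : ℂˣ) : ℂ)‖ < 1) →
            ¬ (∀ u ∈ (Submonoid.pi Set.univ (fun w : PlacesOver L v => (w.1.adicCompletionIntegers L).toSubring.toSubmonoid)).units, χ₁ u = 1) →
            (∃ u : (UnitaryGroup.LocalRing L v)ˣ, (∀ w' : PlacesOver L v, Valued.v (((u : UnitaryGroup.LocalRing L v) w') - 1) < 1) ∧ χ₁ u ≠ 1) →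
            (∃ N : Subrepresentation (UnitaryGroup.cmPrincipalSeries L 3 v (UnitaryGroup.cmTorusCharPair L v χ₁ 1)), N ≠ ⊥ ∧ N ≠ ⊤) →
            χ₁ = halfModulusChar (UnitaryGroup.LocalRing L v) * halfModulusChar (UnitaryGroup.LocalRing L v) ∨
            (∃ η : (UnitaryGroup.LocalRing L v)ˣ →* ℂˣ, IsQuadraticCharExtension (conjLocal L (IsCMField.complexConj L) v) η ∧
              Continuous (fun x => ((η x : ℂˣ) : ℂ)) ∧ χ₁ = η * halfModulusChar (UnitaryGroup.LocalRing L v))) :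
    ∀ (L : Type) [Field L] [NumberField L] [IsCMField L] (v : HeightOneSpectrum (𝓞 ↥(maximalRealSubfield L))),
        (∀ w : PlacesOver L v, IsCMField.complexConj L • w.1 = w.1) →
        ∀ (χ₁ : (UnitaryGroup.LocalRing L v)ˣ →* ℂˣ),
          Continuous (fun x => ((χ₁ x : ℂˣ) : ℂ)) → (∃ x, ‖((χ₁ x : ℂˣ) : ℂ)‖ ≠ 1) →
          (∀ x : (UnitaryGroup.LocalRing L v)ˣ, unitModulusChar (UnitaryGroup.LocalRing L v) x < 1 → ‖((χ₁ x : ℂˣ) : ℂ)‖ < 1) →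
          ¬ (∀ u ∈ (Submonoid.pi Set.univ (fun w : PlacesOver L v => (w.1.adicCompletionIntegers L).toSubring.toSubmonoid)).units, χ₁ u = 1) →
          (∃ N : Subrepresentation (UnitaryGroup.cmPrincipalSeries L 3 v (UnitaryGroup.cmTorusCharPair L v χ₁ 1)), N ≠ ⊥ ∧ N ≠ ⊤) →
          χ₁ = halfModulusChar (UnitaryGroup.LocalRing L v) * halfModulusChar (UnitaryGroup.LocalRing L v) ∨
          (∃ η : (UnitaryGroup.LocalRing L v)ˣ →* ℂˣ, IsQuadraticCharExtension (conjLocal L (IsCMField.complexConj L) v) η ∧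
            Continuous (fun x => ((η x : ℂˣ) : ℂ)) ∧ χ₁ = η * halfModulusChar (UnitaryGroup.LocalRing L v)) := by
  intro L _ _ _ v hns χ₁ h₁ hnu hcontr hram hred
  by_cases hdepth : ∀ u : (UnitaryGroup.LocalRing L v)ˣ,
      (∀ w' : PlacesOver L v, Valued.v (((u : UnitaryGroup.LocalRing L v) w') - 1) < 1) → χ₁ u = 1
  · -- DEPTH ZERO
    by_cases hB : ∀ u : (UnitaryGroup.LocalRing L v)ˣ, (∀ w' : PlacesOver L v, Valued.v ((u : UnitaryGroup.LocalRing L v) w') = 1) →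
        χ₁ (u * Units.map (conjLocal L (IsCMField.complexConj L) v : UnitaryGroup.LocalRing L v →* UnitaryGroup.LocalRing L v) u) = 1
    · -- Branch B: ★ p862943 (U4Keys :155 as a theorem)
      exact K2E3KeysThmTwoContractingRamifiedCharOneDepthZero.keysThmTwo_ramifiedCharOne_depthZero_normTrivial L v hns χ₁ h₁ hnu hcontr hram
        hdepth hB hred
    · -- Branch A: reducibility is absurd (★ p859317)
      push Not at hB
      obtain ⟨u, hu, hA⟩ := hB
      exact absurd hred
        (K2E3BranchAIrreducibleDepthZeroLeaf.not_reducible_of_depthZero_of_normChar_ne_one L v hns χ₁ h₁ hnu hcontr hdepth u hu hA)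
  · -- POSITIVE DEPTH: the letter
    push Not at hdepth
    exact hPos L v hns χ₁ h₁ hnu hcontr hram hdepth hred

end Summit.HodgeConjecture.HodgeConjecture.R90.S1

end
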